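import Summits.Ventures.PercRepro.PuncturedLYMSingleFlux

/-!
# PercRepro — (SP) BY SUPERPOSITION, PART 1: THE SUM OF THE SINGLE-WORD COUPLINGS IS AN EXACT COUPLING UP TO A
ZERO-SUM ERROR ON THE TOUCHED CLIQUES (p10, gen 31; continues PuncturedLYMSingle*)

For a code `D` let `w_B` be the radial single-word coupling of the word `B` (`sW α j (dFlux α j) B`, PuncturedLYMSingle /
PuncturedLYMSingleFlux: row sums `1`, column sums `#P_B/#Y = (j + 1 − τ)/(n − j)`) and put

    superW D X y := Σ_{B ∈ D} w_B(X, X ∪ y) − (#D − 1)/(n − j)      (X ∈ P, y ∉ X).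

* `sum_sups_superWp` — the ROW SUMS are `1` on `P`;
* `sum_subsP_superWp_untouched` — the COLUMN SUM at an untouched `(j+1)`-set is exactly `#P/#Y = (j + 1 − #D·τ)/(n−j)`;
* `sum_subsP_superWp_touched` — the column sum at `Y = insert y₀ B₀` (`B₀ ∈ D`) is `#P/#Y + errE D B₀ y₀`, where
  `errE D B y = Σ_{B' ∈ D, B' ≠ B} (1/(n−j) − w_{B'}(B, B ∪ y))` — the deviation of the row `B` in the other couplings;
* `sum_errE` — the error is ZERO-SUM over the clique of `B`: `Σ_{y ∉ B} errE D B y = 0`.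
The exact re-routing of the error and the nonnegativity bounds are the successor modules.  Nothing here asserts (SP).
-/

namespace PercRepro.PuncturedLYM

open Finset

variable {α : Type} [Fintype α] [DecidableEq α]

/-! ### The column sums of one radial coupling, for every `(j+1)`-set -/

/-- The column sum of the flux coupling of `B` over the `P_B`-subsets of any `(j+1)`-set is `(j + 1 − τ)/(n − j)`
(`0 < j < n`). -/
theorem sum_subsP_sW_dFlux {j : ℕ} {B Y : Finset α} (hB : B.card = j) (hj : 0 < j) (hjn : j < Fintype.card α)
    (hY : Y.card = j + 1) :
    ∑ X ∈ subsP j ({B} : Finset (Finset α)) Y, sWp α j (dFlux α j) B X Y =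
      ((j : ℚ) + 1 - tauQ α j) / ((Fintype.card α : ℚ) - j) := by
  rcases Nat.lt_or_ge (Y ∩ B).card j with hm | hm
  · have hcls : 2 * j + 1 ≤ Fintype.card α + (Y ∩ B).card := by
      have h1 := card_sdiff_add_card_inter Y B
      have h2 : (Y \ B).card + B.card ≤ Fintype.card α := by
        rw [← card_union_of_disjoint sdiff_disjoint]
        exact card_le_univ _
      omega
    rw [sum_subsP_sW_lt (dFlux α j) hB hY hm, col_identity_lt (dFlux α j) hm (dFlux_rec hm hcls)]
  · have hBY : B ⊆ Y := by
      have h2 : Y ∩ B = B := eq_of_subset_of_card_le inter_subset_right (by omega)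
      exact h2 ▸ inter_subset_left
    rw [sum_subsP_sW_top (dFlux α j) hB hY hBY, col_identity_top (dFlux α j) hj (dFlux_top hj hjn)]

/-! ### The superposition weights -/

/-- The superposition weight of the completion `X ↦ insert y X`: the sum of the single-word flux couplings of all the
code words, minus `#D − 1` copies of the uniform coupling `1/(n − j)`. -/
def superW (α : Type) [Fintype α] [DecidableEq α] (j : ℕ) (D : Finset (Finset α)) (X : Finset α) (y : α) : ℚ :=
  (∑ B ∈ D, sW α j (dFlux α j) B X y) - ((D.card : ℚ) - 1) / ((Fintype.card α : ℚ) - j)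

/-- The superposition weights on a pair `(X, Y)`: `superW` at the point of `Y ∖ X`. -/
def superWp (α : Type) [Fintype α] [DecidableEq α] (j : ℕ) (D : Finset (Finset α)) (X Y : Finset α) : ℚ :=
  ∑ y ∈ Y \ X, superW α j D X y

/-- `superWp X (insert y X) = superW X y` for `y ∉ X`. -/
theorem superWp_insert (j : ℕ) (D : Finset (Finset α)) (X : Finset α) {y : α} (hy : y ∉ X) :
    superWp α j D X (insert y X) = superW α j D X y := by
  unfold superWp
  have h : insert y X \ X = {y} := by
    ext z
    simp only [mem_sdiff, mem_insert, mem_singleton]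
    constructor
    · rintro ⟨h1, h2⟩
      exact h1.resolve_right h2
    · rintro rfl
      exact ⟨Or.inl rfl, hy⟩
  rw [h, sum_singleton]

/-- `superWp X Y = Σ_B sWp_B X Y − (#D − 1)/(n − j)` whenever `Y ∖ X` is a single point. -/
theorem superWp_eq {j : ℕ} (D : Finset (Finset α)) {X Y : Finset α} (hXY : (Y \ X).card = 1) :
    superWp α j D X Y = (∑ B ∈ D, sWp α j (dFlux α j) B X Y) - ((D.card : ℚ) - 1) / ((Fintype.card α : ℚ) - j) := by
  obtain ⟨z, hz⟩ := card_eq_one.1 hXY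
  unfold superWp sWp
  rw [hz, sum_singleton]
  simp only [sum_singleton]
  rfl

omit [Fintype α] in
/-- `Y ∖ X` is a single point when `X ⊆ Y`, `#X = j`, `#Y = j + 1`. -/
theorem card_sdiff_eq_one {j : ℕ} {X Y : Finset α} (hX : X.card = j) (hY : Y.card = j + 1) (hXY : X ⊆ Y) :
    (Y \ X).card = 1 := by
  rw [card_sdiff_of_subset hXY]
  omega

/-! ### Row sums -/

/-- **The row sums of the superposition are `1`** at every `X ∈ P` (`j < n`). -/
theorem sum_sups_superWp {j : ℕ} {D : Finset (Finset α)} (hD : IsCode j D) (hjn : j < Fintype.card α)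
    {X : Finset α} (hX : X ∈ punctured j D) : ∑ Y ∈ sups j X, superWp α j D X Y = 1 := by
  obtain ⟨hXc, hXD⟩ := mem_punctured.1 hX
  have h1 : ∀ Y ∈ sups j X, superWp α j D X Y =
      (∑ B ∈ D, sWp α j (dFlux α j) B X Y) - ((D.card : ℚ) - 1) / ((Fintype.card α : ℚ) - j) := by
    intro Y hY
    obtain ⟨hYc, hXY⟩ := mem_sups.1 hY
    exact superWp_eq D (card_sdiff_eq_one hXc hYc hXY)
  rw [sum_congr rfl h1, sum_sub_distrib, sum_comm, sum_const, card_sups hXc, nsmul_eq_mul]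
  have h2 : ∀ B ∈ D, ∑ Y ∈ sups j X, sWp α j (dFlux α j) B X Y = 1 :=
    fun B hB => sum_sups_sW (dFlux α j) (hD.1 B hB) hXc hjn
  rw [sum_congr rfl h2, sum_const, nsmul_eq_mul, mul_one]
  have hnj : ((Fintype.card α : ℚ) - j) ≠ 0 := by
    have : (j : ℚ) < Fintype.card α := by exact_mod_cast hjn
    linarith
  rw [Nat.cast_sub hjn.le, mul_div_assoc', mul_div_cancel_left₀ _ hnj]
  ring

/-! ### The punctured level of a code -/

/-- A code is a family of `j`-subsets. -/
theorem code_subset_powersetCard {j : ℕ} {D : Finset (Finset α)} (hD : IsCode j D) :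
    D ⊆ (univ : Finset α).powersetCard j := by
  intro B hB
  rw [mem_powersetCard]
  exact ⟨subset_univ B, hD.1 B hB⟩

/-- `#P + #D = C(n, j)` for a code. -/
theorem card_punctured_add {j : ℕ} {D : Finset (Finset α)} (hD : IsCode j D) :
    (punctured j D).card + D.card = (Fintype.card α).choose j := by
  unfold punctured
  have := card_sdiff_add_card_eq_card (code_subset_powersetCard hD)
  rw [card_powersetCard, card_univ] at this
  exact this

omit [DecidableEq α] in
/-- `#Y = C(n, j + 1)`. -/
theorem card_levelAbove_eq (j : ℕ) : (levelAbove α j).card = (Fintype.card α).choose (j + 1) := by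
  unfold levelAbove
  rw [card_powersetCard, card_univ]

/-- `#P / #Y = (j + 1 − #D·τ)/(n − j)` for a code (`j < n`). -/
theorem ratio_code {j : ℕ} {D : Finset (Finset α)} (hD : IsCode j D) (hjn : j < Fintype.card α) :
    ((punctured j D).card : ℚ) / (levelAbove α j).card =
      ((j : ℚ) + 1 - D.card * tauQ α j) / ((Fintype.card α : ℚ) - j) := by
  have hP := card_punctured_add hD
  have hY := card_levelAbove_eq (α := α) j
  have hch := Nat.choose_succ_right_eq (Fintype.card α) j
  have hYpos : 0 < (Fintype.card α).choose (j + 1) := Nat.choose_pos hjn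
  have hYq : (0 : ℚ) < ((Fintype.card α).choose (j + 1) : ℕ) := by exact_mod_cast hYpos
  have hnj : ((Fintype.card α : ℚ) - j) ≠ 0 := by
    have : (j : ℚ) < Fintype.card α := by exact_mod_cast hjn
    linarith
  have hPq : ((punctured j D).card : ℚ) = ((Fintype.card α).choose j : ℕ) - D.card := by
    have : ((punctured j D).card : ℚ) + D.card = ((Fintype.card α).choose j : ℕ) := by exact_mod_cast hP
    linarith
  have hchq : (((Fintype.card α).choose (j + 1) : ℕ) : ℚ) * (j + 1) =
      ((Fintype.card α).choose j : ℕ) * ((Fintype.card α : ℚ) - j) := by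
    have : (((Fintype.card α).choose (j + 1) * (j + 1) : ℕ) : ℚ) =
        (((Fintype.card α).choose j * (Fintype.card α - j) : ℕ) : ℚ) := by rw [hch]
    push_cast [Nat.cast_sub hjn.le] at this
    linarith
  rw [hY, hPq]
  unfold tauQ
  rw [div_eq_div_iff hYq.ne' hnj]
  have e : ((j : ℚ) + 1 - D.card * (((Fintype.card α : ℚ) - j) / ((Fintype.card α).choose (j + 1) : ℕ))) *
      ((Fintype.card α).choose (j + 1) : ℕ) =
      ((j : ℚ) + 1) * ((Fintype.card α).choose (j + 1) : ℕ) - D.card * ((Fintype.card α : ℚ) - j) := by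
    field_simp
  rw [e]
  linear_combination (-1 : ℚ) * hchq

/-! ### The `P`-subsets of a `(j+1)`-set, for the code and for one of its words -/

/-- At an untouched `(j+1)`-set the `P`-subsets are all the `j`-subsets. -/
theorem subsP_eq_powersetCard_of_untouched {j : ℕ} {D : Finset (Finset α)} {Y : Finset α}
    (hY : ¬ Touched D Y) : subsP j D Y = Y.powersetCard j := by
  rw [subsP_eq, filter_true_of_mem]
  intro X hX hXD
  exact hY ⟨X, hXD, (mem_powersetCard.1 hX).1⟩

/-- For a word `B ⊄ Y` the `P_B`-subsets of `Y` are all the `j`-subsets. -/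
theorem subsP_singleton_eq_powersetCard {j : ℕ} {B Y : Finset α} (hBY : ¬ B ⊆ Y) :
    subsP j ({B} : Finset (Finset α)) Y = Y.powersetCard j := by
  apply subsP_eq_powersetCard_of_untouched
  rw [touched_singleton_iff]
  exact hBY

/-- At a `(j+1)`-set touched by `B₀ ∈ D`, the `P`-subsets of the code are those of the word `B₀`. -/
theorem subsP_eq_singleton_of_touched {j : ℕ} {D : Finset (Finset α)} (hD : IsCode j D) {B₀ Y : Finset α}
    (hB₀ : B₀ ∈ D) (hY : Y.card = j + 1) (hB₀Y : B₀ ⊆ Y) :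
    subsP j D Y = subsP j ({B₀} : Finset (Finset α)) Y := by
  rw [subsP_eq, subsP_eq]
  apply filter_congr
  intro X hX
  rw [mem_powersetCard] at hX
  rw [mem_singleton]
  constructor
  · intro h h'
    exact h (h' ▸ hB₀)
  · intro h h'
    exact h (code_unique_of_subset hD h' hB₀ hY hX.1 hB₀Y)

/-- At a `(j+1)`-set touched by `B₀ ∈ D`, the `P_B`-subsets of another word `B` are the `P`-subsets plus `B₀`. -/
theorem subsP_singleton_eq_insert_of_touched {j : ℕ} {D : Finset (Finset α)} (hD : IsCode j D) {B₀ B Y : Finset α}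
    (hB₀ : B₀ ∈ D) (hB : B ∈ D) (hne : B ≠ B₀) (hY : Y.card = j + 1) (hB₀Y : B₀ ⊆ Y) :
    subsP j ({B} : Finset (Finset α)) Y = insert B₀ (subsP j D Y) ∧ B₀ ∉ subsP j D Y := by
  have hBY : ¬ B ⊆ Y := fun h => hne (code_unique_of_subset hD hB hB₀ hY h hB₀Y)
  refine ⟨?_, ?_⟩
  · rw [subsP_singleton_eq_powersetCard hBY, subsP_eq]
    ext X
    simp only [mem_insert, mem_filter, mem_powersetCard]
    constructor
    · rintro ⟨hXY, hXc⟩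
      by_cases hXD : X ∈ D
      · left
        exact code_unique_of_subset hD hXD hB₀ hY hXY hB₀Y
      · right
        exact ⟨⟨hXY, hXc⟩, hXD⟩
    · rintro (hXB | ⟨h, -⟩)
      · rw [hXB]
        exact ⟨hB₀Y, hD.1 B₀ hB₀⟩
      · exact h
  · rw [mem_subsP]
    rintro ⟨⟨-, h⟩, -⟩
    exact h hB₀

/-! ### The error on a touched clique -/

/-- The ERROR of the superposition at the touched set `insert y B`: the deviation of the row `B` in the other
couplings, `Σ_{B' ∈ D, B' ≠ B} (1/(n−j) − w_{B'}(B, B ∪ y))`. -/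
def errE (α : Type) [Fintype α] [DecidableEq α] (j : ℕ) (D : Finset (Finset α)) (B : Finset α) (y : α) : ℚ :=
  ∑ B' ∈ D.erase B, (1 / ((Fintype.card α : ℚ) - j) - sW α j (dFlux α j) B' B y)

/-- **The column sum at an untouched `(j+1)`-set is exactly `#P/#Y`** (`0 < j < n`). -/
theorem sum_subsP_superWp_untouched {j : ℕ} {D : Finset (Finset α)} (hD : IsCode j D) (hj : 0 < j)
    (hjn : j < Fintype.card α) {Y : Finset α} (hY : Y.card = j + 1) (hT : ¬ Touched D Y) :
    ∑ X ∈ subsP j D Y, superWp α j D X Y = ((j : ℚ) + 1 - D.card * tauQ α j) / ((Fintype.card α : ℚ) - j) := by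
  have h1 : ∀ X ∈ subsP j D Y, superWp α j D X Y =
      (∑ B ∈ D, sWp α j (dFlux α j) B X Y) - ((D.card : ℚ) - 1) / ((Fintype.card α : ℚ) - j) := by
    intro X hX
    obtain ⟨⟨hXc, -⟩, hXY⟩ := mem_subsP.1 hX
    exact superWp_eq D (card_sdiff_eq_one hXc hY hXY)
  rw [sum_congr rfl h1, sum_sub_distrib, sum_comm, sum_const, nsmul_eq_mul]
  have hcard : (subsP j D Y).card = j + 1 := by
    have := card_subsP hD hY
    rw [if_neg hT] at this
    omega
  have h2 : ∀ B ∈ D, ∑ X ∈ subsP j D Y, sWp α j (dFlux α j) B X Y =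
      ((j : ℚ) + 1 - tauQ α j) / ((Fintype.card α : ℚ) - j) := by
    intro B hB
    have hBY : ¬ B ⊆ Y := fun h => hT ⟨B, hB, h⟩
    rw [subsP_eq_powersetCard_of_untouched hT, ← subsP_singleton_eq_powersetCard (j := j) hBY]
    exact sum_subsP_sW_dFlux (hD.1 B hB) hj hjn hY
  rw [sum_congr rfl h2, sum_const, nsmul_eq_mul, hcard]
  push_cast
  ring

/-- **The column sum at a touched `(j+1)`-set `insert y₀ B₀` is `#P/#Y + errE D B₀ y₀`** (`0 < j < n`). -/
theorem sum_subsP_superWp_touched {j : ℕ} {D : Finset (Finset α)} (hD : IsCode j D) (hj : 0 < j)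
    (hjn : j < Fintype.card α) {B₀ : Finset α} (hB₀ : B₀ ∈ D) {y₀ : α} (hy₀ : y₀ ∉ B₀) :
    ∑ X ∈ subsP j D (insert y₀ B₀), superWp α j D X (insert y₀ B₀) =
      ((j : ℚ) + 1 - D.card * tauQ α j) / ((Fintype.card α : ℚ) - j) + errE α j D B₀ y₀ := by
  have hB₀c := hD.1 B₀ hB₀
  have hY : (insert y₀ B₀).card = j + 1 := by rw [card_insert_of_notMem hy₀, hB₀c]
  have hB₀Y : B₀ ⊆ insert y₀ B₀ := subset_insert _ _
  have hT : Touched D (insert y₀ B₀) := ⟨B₀, hB₀, hB₀Y⟩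
  have h1 : ∀ X ∈ subsP j D (insert y₀ B₀), superWp α j D X (insert y₀ B₀) =
      (∑ B ∈ D, sWp α j (dFlux α j) B X (insert y₀ B₀)) - ((D.card : ℚ) - 1) / ((Fintype.card α : ℚ) - j) := by
    intro X hX
    obtain ⟨⟨hXc, -⟩, hXY⟩ := mem_subsP.1 hX
    exact superWp_eq D (card_sdiff_eq_one hXc hY hXY)
  rw [sum_congr rfl h1, sum_sub_distrib, sum_comm, sum_const, nsmul_eq_mul]
  have hcard : (subsP j D (insert y₀ B₀)).card = j := by
    have := card_subsP hD hY
    rw [if_pos hT] at this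
    omega
  -- the column of each `w_B` over the `P`-subsets: the full column minus the row `B₀` (for `B ≠ B₀`)
  have h2 : ∀ B ∈ D, ∑ X ∈ subsP j D (insert y₀ B₀), sWp α j (dFlux α j) B X (insert y₀ B₀) =
      ((j : ℚ) + 1 - tauQ α j) / ((Fintype.card α : ℚ) - j)
        - (if B = B₀ then 0 else sWp α j (dFlux α j) B B₀ (insert y₀ B₀)) := by
    intro B hB
    split_ifs with hBB₀
    · subst hBB₀
      rw [sub_zero, subsP_eq_singleton_of_touched hD hB hY hB₀Y]
      exact sum_subsP_sW_dFlux hB₀c hj hjn hY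
    · obtain ⟨heq, hnot⟩ := subsP_singleton_eq_insert_of_touched hD hB₀ hB hBB₀ hY hB₀Y
      have := sum_subsP_sW_dFlux (hD.1 B hB) hj hjn hY (B := B) (Y := insert y₀ B₀)
      rw [heq, sum_insert hnot] at this
      linarith
  rw [sum_congr rfl h2, sum_sub_distrib, sum_const, nsmul_eq_mul, hcard]
  -- `Σ_{B ∈ D, B ≠ B₀} sWp_B B₀ Y = Σ_{B ∈ D.erase B₀} sW_B B₀ y₀`
  have h3 : ∑ B ∈ D, (if B = B₀ then (0 : ℚ) else sWp α j (dFlux α j) B B₀ (insert y₀ B₀)) =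
      ∑ B ∈ D.erase B₀, sW α j (dFlux α j) B B₀ y₀ := by
    rw [← sum_erase_add _ _ hB₀, if_pos rfl, add_zero]
    apply sum_congr rfl
    intro B hB
    rw [if_neg (ne_of_mem_erase hB), sWp_insert j (dFlux α j) B B₀ hy₀]
  rw [h3]
  unfold errE
  rw [sum_sub_distrib, sum_const, card_erase_of_mem hB₀, nsmul_eq_mul]
  have hnj : ((Fintype.card α : ℚ) - j) ≠ 0 := by
    have : (j : ℚ) < Fintype.card α := by exact_mod_cast hjn
    linarith
  have hDpos : 1 ≤ D.card := card_pos.2 ⟨B₀, hB₀⟩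
  rw [Nat.cast_sub hDpos]
  push_cast
  field_simp
  ring

/-- **The error is zero-sum over the clique of `B`**: `Σ_{y ∉ B} errE D B y = 0` (`j < n`, `B ∈ D`). -/
theorem sum_errE {j : ℕ} {D : Finset (Finset α)} (hD : IsCode j D) (hjn : j < Fintype.card α) {B : Finset α}
    (hB : B ∈ D) : ∑ y ∈ univ \ B, errE α j D B y = 0 := by
  unfold errE
  rw [sum_comm]
  apply sum_eq_zero
  intro B' hB'
  rw [sum_sub_distrib, sum_const, card_univ_sdiff, hD.1 B hB, nsmul_eq_mul]
  have hrow := sum_sups_sW (dFlux α j) (hD.1 B' (mem_of_mem_erase hB')) (hD.1 B hB) hjn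
  rw [sum_sups (hD.1 B hB)] at hrow
  have h1 : ∀ y ∈ univ \ B, sWp α j (dFlux α j) B' B (insert y B) = sW α j (dFlux α j) B' B y :=
    fun y hy => sWp_insert j (dFlux α j) B' B (mem_sdiff.1 hy).2
  rw [sum_congr rfl h1] at hrow
  rw [hrow]
  have hnj : ((Fintype.card α : ℚ) - j) ≠ 0 := by
    have : (j : ℚ) < Fintype.card α := by exact_mod_cast hjn
    linarith
  rw [Nat.cast_sub hjn.le, mul_one_div_cancel hnj, sub_self]

end PercRepro.PuncturedLYM
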